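import Literature.MathematicalPhysics.QuantumLattice.SectorisedKernelNormRefinement
import Literature.MathematicalPhysics.QuantumLattice.SectorisedKernelNormRefinementSplit
import Literature.MathematicalPhysics.QuantumLattice.SectorisedKernelNormResectorisation
import HarnessLib

/-!
# Re-sectorisation across a plateau pair WITH THE RELATIVE SECTOR COUNT (Hubbard layer of `SectorisedKernelNormRefinement`)

Topic `MathematicalPhysics/QuantumLattice`; companion of `SectorisedKernelNormResectorisation` (the FLAT re-sectorisation
`‖G‖_{F′,A″} ≤ cr·cc^m·ε^m·(ε‖G‖_{F,univ})`, every child of every leg counted) and of `SectorisedKernelNormRefinement` (the generic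
anchored-sum bookkeeping with a refinement count).  Benfatto–Giuliani–Mastropietro 2006, §2.8 (2.82)–(2.83) with (2.89): when the
kernels sectorised in a COARSE family `F` (thin/fat pair `F, F̃`: `F̃F = F`) are rewritten in a FINER family `F′` living in the plateau
`{Σ_ω F_ω = 1}`, the price per vertex is ONE overlap `L¹` norm per leg, (2.82), times the NUMBER OF ADMISSIBLE FINE TUPLES REFINING THE
COARSE ONE through the anchored leg — the relative sector counting lemma (2.89)/(A3.1), `c^L γ^{(h−h′)(L−3)/2}` — and NOT the flat
product of the per-leg child counts.  Here the count enters as a parameter `R`: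

* **`hubbardSectorKernelNorm_refine_le_of_plateau_pair`** — for a relation `child ω″ ω′` containing the support overlap of the pair
  (`¬ child ω″ ω′ ⇒ F′_{ω″}·F̃_{ω′} ≡ 0`), per-pair position sums `Σ_{x″} ‖(E(F′)S(F̃))((x″,ℓ″),X′)‖ ≤ c₁`, row sums `≤ cr`, and `R`
  bounding, for every coarse label tuple `σ′`, leg `p` and fine label `ℓ″`, the number of `σ″ ∈ A″` with `σ″_p = ℓ″` whose legs are
  leg-wise children of `σ′` (same spin and charge, `child` on the sector indices): in every degree `m + 1`,
  `hubbardSectorKernelNorm β F′ A″ G ≤ cr · c₁^m · R · ε_x^m · (ε_x · hubbardSectorKernelNorm β F univ G)`.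

* `kernel_sectorPreimage_eq_sectorisedKernel` — the kernels of the sector preimage ARE `ε_x^m ·` the sectorised kernels (no
  antisymmetrisation loss: the sectorised kernels are kernels of the analysed polynomial, `kernel_map_sectorAnalysis`);
* **`hubbardSectorKernelNorm_refine_le_split_of_plateau_pair`** — the CORRELATED-count version (`SectorisedKernelNormRefinementSplit`): with a
  class `B` of coarse label tuples and counts `R₁` off `B`, `R₂` on `B`,
  `hubbardSectorKernelNorm β F′ A″ G ≤ cr · c₁^m · ε_x^m · (R₁ · (ε_x · ‖G‖_{F,univ}) + R₂ · (ε_x · ‖G‖_{F,B}))` — the slot for the umklapp-corner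
  class of the lattice relative count (cell gate-hubbard-kl, p4 COUNTING-NOTE-2 §5(c1)).

* `hubbardSectorPinnedSum_refine_le_of_plateau_pair` — the PER-TUPLE companion (`SectorisedKernelNormRefinement.pinnedSum_refine_le`): for one
  fine label tuple `σ″`, `ε_x^m Σ_{x″_p = x} ‖W_{F′,σ″}(x″)‖ ≤ c₁^m · c₁r · P · ε_x^m · (ε_x · B)` from per-pair column AND row position sums, the
  number `P` of coarse tuples `σ″` refines, and a bound `B` on the pinned sizes of the single coarse tuples — so the tower can carry
  (anchored sum, per-tuple size) pairs, which is what the correlated count needs.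

With `R = (max children)^m` and `c₁ ≤ cc` this is the flat bound again; with `A″ = bgmSectorSet F′ (m+1)` and `R` the relative count of
the sector counting lemma it is BGM's per-vertex bookkeeping (cell gate-hubbard-kl, K3 engine child (E1): E1-CORE-TARGET CT-2(ii), the
re-measurement of an increment born at one scale in the sectors of a lower one; the count itself — row (V) of the H10 frame file today,
Lemma A3.1 when typed — is supplied by the counting lane).  Everything is proved; no definition, no named fact.

## Sources

G. Benfatto, A. Giuliani, V. Mastropietro, Ann. Henri Poincaré 7 (2006) 809–898 = arXiv:cond-mat/0507686, §2.7 (2.70)–(2.71a),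
§2.8 (2.82)–(2.83), (2.89), App. A3 Lemma A3.1 [`BenfattoGiulianiMastropietro2006`].
-/

noncomputable section

namespace Literature.MathematicalPhysics.QuantumLattice

open GrassmannAlgebra Finset Literature.Probability.LatticeModels

variable {L M : ℕ} [NeZero L] [NeZero M] {N N' : ℕ}

omit [NeZero L] [NeZero M] in
/-- Splitting a sum over tuples of (position, label) pairs into the label tuples and the position tuples. [folklore] -/
private theorem sum_tuple_prod_eq_sum_sum {α : Type*} [AddCommMonoid α] {P S : Type*} [Fintype P] [Fintype S] (n : ℕ)
    (g : (Fin n → P × S) → α) : ∑ Y, g Y = ∑ σ : Fin n → S, ∑ x : Fin n → P, g (fun i => (x i, σ i)) := by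
  rw [← (Equiv.arrowProdEquivProdArrow (Fin n) (fun _ => P) (fun _ => S)).symm.sum_comp, Fintype.sum_prod_type, sum_comm]
  rfl

omit [NeZero M] in
/-- **The overlap kernel of a plateau pair vanishes off the child relation**: if `¬ child ω″ ω′ ⇒ F′_{ω″}(k)·F̃_{ω′}(k) = 0` for all `k`,
then `(E(F′)S(F̃))((x″,ℓ″),(x′,ℓ′)) = 0` unless `child ℓ″.ω ℓ′.ω`, `ℓ′.σ = ℓ″.σ` and `ℓ′.c = ℓ″.c`.
[cite: BenfattoGiulianiMastropietro2006, §2.7 (2.71)] -/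
theorem sectorAnalysis_mul_sectorSub_eq_zero_of_not_child (β : ℝ) (F' : Fin N' → FreqMomentum L M → ℂ)
    (Ft : Fin N → FreqMomentum L M → ℂ) (child : Fin N' → Fin N → Prop)
    (hchild : ∀ ω'' ω', ¬ child ω'' ω' → ∀ k, F' ω'' k * Ft ω' k = 0)
    (x'' : SpaceTimeIdx L M) (ℓ'' : SectorLeg N') (x' : SpaceTimeIdx L M) (ℓ' : SectorLeg N)
    (h : ¬ (child ℓ''.1.1 ℓ'.1.1 ∧ ℓ'.1.2 = ℓ''.1.2 ∧ ℓ'.2 = ℓ''.2)) :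
    (sectorAnalysisMatrix L M β F' * sectorSubMatrix L M β Ft) (x'', ℓ'') (x', ℓ') = 0 := by
  rw [sectorAnalysis_mul_sectorSub_apply]
  by_cases hlab : ℓ'.1.2 = ℓ''.1.2 ∧ ℓ'.2 = ℓ''.2
  · have hc : ¬ child ℓ''.1.1 ℓ'.1.1 := fun hc => h ⟨hc, hlab⟩
    rw [if_pos hlab]
    refine sum_eq_zero fun k _ => ?_
    have h0 := hchild _ _ hc k
    calc F' ℓ''.1.1 k * hubbardPlaneWave L M β ℓ''.2 k x'' *
          ((((1 / (β * (L : ℝ) ^ 2) : ℝ) : ℂ) * (Ft ℓ'.1.1 k * (starRingEnd ℂ) (hubbardPlaneWave L M β ℓ'.2 k x'))))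
        = (F' ℓ''.1.1 k * Ft ℓ'.1.1 k) * (hubbardPlaneWave L M β ℓ''.2 k x'' *
            ((((1 / (β * (L : ℝ) ^ 2) : ℝ) : ℂ) * (starRingEnd ℂ) (hubbardPlaneWave L M β ℓ'.2 k x')))) := by ring
      _ = 0 := by rw [h0, zero_mul]
  · exact if_neg hlab

/-- **Re-sectorisation across a plateau pair with the relative sector count** (BGM 2006, (2.82)–(2.83) with (2.89)): for a thin/fat
pair `F, F̃` (`F̃F = F`, `Σ_ω F_ω(k) = 0 ⇒ F_ω(k) = 0`), a family `F′` supported in the plateau of `F`, a relation `child` with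
`¬ child ω″ ω′ ⇒ F′_{ω″}·F̃_{ω′} ≡ 0`, per-pair position sums `Σ_{x″} ‖(E(F′)S(F̃))((x″,ℓ″),X′)‖ ≤ c₁`, row sums `Σ_{X′} ‖(E(F′)S(F̃))(X″,X′)‖ ≤ cr`,
and a bound `R` on the number of `σ″ ∈ A″` through a pinned leg `σ″_p = ℓ″` that are leg-wise children (same spin and charge, `child` on
the sector index) of any given coarse tuple `σ′`: in every degree `m + 1`,
`hubbardSectorKernelNorm β F′ A″ G ≤ cr · c₁^m · R · ε_x^m · (ε_x · hubbardSectorKernelNorm β F univ G)`.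
[cite: BenfattoGiulianiMastropietro2006, §2.8 (2.82)-(2.83) and (2.89)] -/
theorem hubbardSectorKernelNorm_refine_le_of_plateau_pair {β : ℝ} (hβ : 0 < β) (F Ft : Fin N → FreqMomentum L M → ℂ)
    (hFF : ∀ ω k, Ft ω k * F ω k = F ω k) (hF0 : ∀ k, ∑ ω, F ω k = 0 → ∀ ω, F ω k = 0) (F' : Fin N' → FreqMomentum L M → ℂ)
    (hF'pl : ∀ (ω' : Fin N') (k : FreqMomentum L M), F' ω' k ≠ 0 → ∑ ω, F ω k = 1) (G : HubbardGrassmann L M)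
    (child : Fin N' → Fin N → Prop) [DecidableRel child]
    (hchild : ∀ ω'' ω', ¬ child ω'' ω' → ∀ k, F' ω'' k * Ft ω' k = 0)
    {cr c₁ R : ℝ} (hcr0 : 0 ≤ cr) (hc₁0 : 0 ≤ c₁) (hR0 : 0 ≤ R)
    (hrow' : ∀ X'', ∑ X', ‖(sectorAnalysisMatrix L M β F' * sectorSubMatrix L M β Ft) X'' X'‖ ≤ cr)
    (hcol₁ : ∀ (ℓ'' : SectorLeg N') (X' : SpaceTimeIdx L M × SectorLeg N),
      ∑ x'' : SpaceTimeIdx L M, ‖(sectorAnalysisMatrix L M β F' * sectorSubMatrix L M β Ft) (x'', ℓ'') X'‖ ≤ c₁)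
    (m : ℕ) (A'' : Finset (Fin (m + 1) → SectorLeg N'))
    (hR : ∀ (σ' : Fin (m + 1) → SectorLeg N) (p : Fin (m + 1)) (ℓ'' : SectorLeg N'),
      (((A''.filter fun σ'' => σ'' p = ℓ'' ∧
          ∀ i, child (σ'' i).1.1 (σ' i).1.1 ∧ (σ' i).1.2 = (σ'' i).1.2 ∧ (σ' i).2 = (σ'' i).2).card : ℝ)) ≤ R) :
    hubbardSectorKernelNorm L M β F' A'' G ≤
      cr * c₁ ^ m * R * imagTimeWeight β M ^ m *
        (imagTimeWeight β M * hubbardSectorKernelNorm L M β F (univ : Finset (Fin (m + 1) → SectorLeg N)) G) := by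
  have hε : 0 ≤ imagTimeWeight β M := imagTimeWeight_nonneg hβ.le M
  set T : SpaceTimeIdx L M × SectorLeg N' → SpaceTimeIdx L M × SectorLeg N → ℂ :=
    fun X'' X' => (sectorAnalysisMatrix L M β F' * sectorSubMatrix L M β Ft) X'' X' with hT
  set K' : (Fin (m + 1) → SpaceTimeIdx L M × SectorLeg N) → ℂ := kernel ℂ (sectorPreimage β F G) (m + 1) with hK'
  -- the fine sectorised kernels are the leg-wise transform of the preimage's kernels
  have hker : sectorisedKernel L M β F' G (m + 1) = fun σ'' x'' =>
      ∑ σ' : Fin (m + 1) → SectorLeg N, ∑ x' : Fin (m + 1) → SpaceTimeIdx L M,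
        (∏ i, T (x'' i, σ'' i) (x' i, σ' i)) * K' (fun i => (x' i, σ' i)) := by
    funext σ'' x''
    show sectorisedKernel L M β F' G (m + 1) σ'' x'' =
      ∑ σ' : Fin (m + 1) → SectorLeg N, ∑ x' : Fin (m + 1) → SpaceTimeIdx L M,
        (∏ i, T (x'' i, σ'' i) (x' i, σ' i)) * K' (fun i => (x' i, σ' i))
    have h1 : kernel ℂ (ExteriorAlgebra.map (Matrix.toLin' (sectorAnalysisMatrix L M β F')) G) (m + 1) (fun i => (x'' i, σ'' i)) =
        sectorisedKernel L M β F' G (m + 1) σ'' x'' := by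
      simpa only using kernel_map_sectorAnalysis β F' G (m + 1) (fun i => (x'' i, σ'' i))
    rw [← h1, map_sectorAnalysis_eq_map_comp_sectorPreimage_of_plateau hβ.ne' F Ft hFF hF0 F' hF'pl G, kernel_map,
      LinearMap.toMatrix'_comp, LinearMap.toMatrix'_toLin', LinearMap.toMatrix'_toLin']
    exact sum_tuple_prod_eq_sum_sum (m + 1) _
  -- the generic refinement bookkeeping
  rw [hubbardSectorKernelNorm_def, hker]
  have href := sectorisedKernelNorm_refine_le (𝕜 := ℂ) hε T
    (fun (ℓ'' : SectorLeg N') (ℓ' : SectorLeg N) => child ℓ''.1.1 ℓ'.1.1 ∧ ℓ'.1.2 = ℓ''.1.2 ∧ ℓ'.2 = ℓ''.2)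
    (fun x'' ℓ'' x' ℓ' h => sectorAnalysis_mul_sectorSub_eq_zero_of_not_child β F' Ft child hchild x'' ℓ'' x' ℓ' h)
    hc₁0 hcr0 hR0 (fun ℓ'' x' ℓ' => hcol₁ ℓ'' (x', ℓ')) hrow' A'' (fun σ' p ℓ'' => by convert hR σ' p ℓ'' using 4) (fun σ' x' => K' (fun i => (x' i, σ' i)))
  refine href.trans ?_
  rw [mul_assoc (cr * c₁ ^ m * R)]
  refine mul_le_mul_of_nonneg_left ?_ (by positivity)
  -- the preimage's kernels in the sectorised currency
  calc sectorisedKernelNorm (imagTimeWeight β M) (m + 1) univ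
        (fun (σ' : Fin (m + 1) → SectorLeg N) (x' : Fin (m + 1) → SpaceTimeIdx L M) => K' (fun i => (x' i, σ' i)))
      ≤ kernelNorm (imagTimeWeight β M) (m + 1) K' := sectorisedKernelNorm_le_kernelNorm_prod hε univ _
    _ = imagTimeWeight β M ^ m * kernelNorm 1 (m + 1) K' := kernelNorm_eq_pow_mul_kernelNorm_one hε _ _
    _ ≤ _ := mul_le_mul_of_nonneg_left (kernelNorm_kernel_sectorPreimage_le hβ.le F G m) (pow_nonneg hε m)

omit [NeZero M] in
/-- **The kernels of the sector preimage are `ε_x^m` times the sectorised kernels** (BGM 2006, (2.70): `𝒱̃` is presented by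
`ε_x^m W̃_{m,Ω}(x)`, and these are already antisymmetric — they are the kernels of the analysed polynomial, `kernel_map_sectorAnalysis`):
`kernel (sectorPreimage β F G) m Y = ε_x^m · W_{F,m}(ℓ∘Y)(x∘Y)`. [cite: BenfattoGiulianiMastropietro2006, §2.7 (2.70)] -/
theorem kernel_sectorPreimage_eq_sectorisedKernel (β : ℝ) (F : Fin N → FreqMomentum L M → ℂ) (G : HubbardGrassmann L M) (m : ℕ)
    (Y : Fin m → SpaceTimeIdx L M × SectorLeg N) :
    kernel ℂ (sectorPreimage β F G) m Y =
      ((imagTimeWeight β M : ℝ) : ℂ) ^ m * sectorisedKernel L M β F G m (fun i => (Y i).2) (fun i => (Y i).1) := by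
  rw [kernel_sectorPreimage]
  set H := ExteriorAlgebra.map (Matrix.toLin' (sectorAnalysisMatrix L M β F)) G with hH
  -- the kernels of `H` are already antisymmetric: `kernel (presented (kernel H m)) m = kernel H m`
  have hpk : ∀ Y' : Fin m → SpaceTimeIdx L M × SectorLeg N, kernel ℂ (presented ℂ (kernel ℂ H m)) m Y' = kernel ℂ H m Y' := by
    intro Y'
    by_cases hm' : m ∈ range (Fintype.card (SpaceTimeIdx L M × SectorLeg N) + 1)
    · conv_rhs => rw [eq_sum_presented_kernel ℂ H, kernel_sum]
      rw [sum_eq_single_of_mem m hm' fun m'' _ hne => kernel_presented_of_ne ℂ _ Y' (Ne.symm hne)]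
    · have hzero : ∀ Z : Fin m → SpaceTimeIdx L M × SectorLeg N, kernel ℂ H m Z = 0 := by
        intro Z
        conv_lhs => rw [eq_sum_presented_kernel ℂ H, kernel_sum]
        exact sum_eq_zero fun m'' hm'' => kernel_presented_of_ne ℂ _ Z (by rintro rfl; exact hm' hm'')
      rw [hzero Y', show kernel ℂ H m = 0 from funext hzero, presented_zero, kernel_zero_right]
  split_ifs with hm
  · have hφ : (fun Y : Fin m → SpaceTimeIdx L M × SectorLeg N =>
        ((imagTimeWeight β M : ℝ) : ℂ) ^ m * sectorisedKernel L M β F G m (fun i => (Y i).2) (fun i => (Y i).1)) =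
        (((imagTimeWeight β M : ℝ) : ℂ) ^ m) • kernel ℂ H m := by
      funext Y
      rw [Pi.smul_apply, smul_eq_mul, hH, kernel_map_sectorAnalysis]
    rw [hφ, presented_smul, kernel_smul, hpk Y, hH, kernel_map_sectorAnalysis]
  · -- above the top degree of `G` every kernel of `G`, hence of `H`, vanishes
    rw [not_le] at hm
    have hG0 : ∀ X : Fin m → HubbardFieldIdx L M, kernel ℂ G m X = 0 := by
      intro X
      conv_lhs => rw [eq_sum_presented_kernel ℂ G, kernel_sum]
      exact sum_eq_zero fun k hk => kernel_presented_of_ne ℂ _ X (by have := mem_range.1 hk; omega)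
    have h0 : kernel ℂ H m Y = 0 := by
      rw [hH, kernel_map]
      exact sum_eq_zero fun X _ => by rw [hG0 X, mul_zero]
    rw [hH, kernel_map_sectorAnalysis] at h0
    rw [h0, mul_zero]


/-- **Re-sectorisation across a plateau pair with a CORRELATED relative sector count** (BGM 2006 (2.82)–(2.83), (2.89), with a count that
depends on the class of the coarse tuple): data as in `hubbardSectorKernelNorm_refine_le_of_plateau_pair`, plus a class `B` of coarse label
tuples; the number of `σ″ ∈ A″` through a pinned leg that are leg-wise children of `σ′` is `≤ R₁` for `σ′ ∉ B` and `≤ R₂` for `σ′ ∈ B`.  Then in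
every degree `m + 1`,
`hubbardSectorKernelNorm β F′ A″ G ≤ cr · c₁^m · ε_x^m · (R₁ · (ε_x · ‖G‖_{F,univ}) + R₂ · (ε_x · ‖G‖_{F,B}))`.
[cite: BenfattoGiulianiMastropietro2006, §2.8 (2.82)-(2.83) and (2.89)] -/
theorem hubbardSectorKernelNorm_refine_le_split_of_plateau_pair {β : ℝ} (hβ : 0 < β) (F Ft : Fin N → FreqMomentum L M → ℂ)
    (hFF : ∀ ω k, Ft ω k * F ω k = F ω k) (hF0 : ∀ k, ∑ ω, F ω k = 0 → ∀ ω, F ω k = 0) (F' : Fin N' → FreqMomentum L M → ℂ)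
    (hF'pl : ∀ (ω' : Fin N') (k : FreqMomentum L M), F' ω' k ≠ 0 → ∑ ω, F ω k = 1) (G : HubbardGrassmann L M)
    (child : Fin N' → Fin N → Prop) [DecidableRel child]
    (hchild : ∀ ω'' ω', ¬ child ω'' ω' → ∀ k, F' ω'' k * Ft ω' k = 0)
    {cr c₁ R₁ R₂ : ℝ} (hcr0 : 0 ≤ cr) (hc₁0 : 0 ≤ c₁) (hR₁ : 0 ≤ R₁) (hR₂ : 0 ≤ R₂)
    (hrow' : ∀ X'', ∑ X', ‖(sectorAnalysisMatrix L M β F' * sectorSubMatrix L M β Ft) X'' X'‖ ≤ cr)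
    (hcol₁ : ∀ (ℓ'' : SectorLeg N') (X' : SpaceTimeIdx L M × SectorLeg N),
      ∑ x'' : SpaceTimeIdx L M, ‖(sectorAnalysisMatrix L M β F' * sectorSubMatrix L M β Ft) (x'', ℓ'') X'‖ ≤ c₁)
    (m : ℕ) (A'' : Finset (Fin (m + 1) → SectorLeg N')) (B : Finset (Fin (m + 1) → SectorLeg N))
    (hRoff : ∀ (σ' : Fin (m + 1) → SectorLeg N), σ' ∉ B → ∀ (p : Fin (m + 1)) (ℓ'' : SectorLeg N'),
      (((A''.filter fun σ'' => σ'' p = ℓ'' ∧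
          ∀ i, child (σ'' i).1.1 (σ' i).1.1 ∧ (σ' i).1.2 = (σ'' i).1.2 ∧ (σ' i).2 = (σ'' i).2).card : ℝ)) ≤ R₁)
    (hRon : ∀ (σ' : Fin (m + 1) → SectorLeg N), σ' ∈ B → ∀ (p : Fin (m + 1)) (ℓ'' : SectorLeg N'),
      (((A''.filter fun σ'' => σ'' p = ℓ'' ∧
          ∀ i, child (σ'' i).1.1 (σ' i).1.1 ∧ (σ' i).1.2 = (σ'' i).1.2 ∧ (σ' i).2 = (σ'' i).2).card : ℝ)) ≤ R₂) :
    hubbardSectorKernelNorm L M β F' A'' G ≤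
      cr * c₁ ^ m * imagTimeWeight β M ^ m *
        (R₁ * (imagTimeWeight β M * hubbardSectorKernelNorm L M β F (univ : Finset (Fin (m + 1) → SectorLeg N)) G) +
          R₂ * (imagTimeWeight β M * hubbardSectorKernelNorm L M β F B G)) := by
  have hε : 0 ≤ imagTimeWeight β M := imagTimeWeight_nonneg hβ.le M
  set T : SpaceTimeIdx L M × SectorLeg N' → SpaceTimeIdx L M × SectorLeg N → ℂ :=
    fun X'' X' => (sectorAnalysisMatrix L M β F' * sectorSubMatrix L M β Ft) X'' X' with hT
  -- the fine sectorised kernels are the leg-wise transform of `ε^{m+1} ·` the coarse ones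
  have hker : sectorisedKernel L M β F' G (m + 1) = fun σ'' x'' =>
      ∑ σ' : Fin (m + 1) → SectorLeg N, ∑ x' : Fin (m + 1) → SpaceTimeIdx L M,
        (∏ i, T (x'' i, σ'' i) (x' i, σ' i)) *
          ((((imagTimeWeight β M : ℝ) : ℂ) ^ (m + 1)) • sectorisedKernel L M β F G (m + 1)) σ' x' := by
    funext σ'' x''
    show sectorisedKernel L M β F' G (m + 1) σ'' x'' =
      ∑ σ' : Fin (m + 1) → SectorLeg N, ∑ x' : Fin (m + 1) → SpaceTimeIdx L M,
        (∏ i, T (x'' i, σ'' i) (x' i, σ' i)) *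
          ((((imagTimeWeight β M : ℝ) : ℂ) ^ (m + 1)) • sectorisedKernel L M β F G (m + 1)) σ' x'
    have h1 : kernel ℂ (ExteriorAlgebra.map (Matrix.toLin' (sectorAnalysisMatrix L M β F')) G) (m + 1) (fun i => (x'' i, σ'' i)) =
        sectorisedKernel L M β F' G (m + 1) σ'' x'' := by
      simpa only using kernel_map_sectorAnalysis β F' G (m + 1) (fun i => (x'' i, σ'' i))
    rw [← h1, map_sectorAnalysis_eq_map_comp_sectorPreimage_of_plateau hβ.ne' F Ft hFF hF0 F' hF'pl G, kernel_map,
      LinearMap.toMatrix'_comp, LinearMap.toMatrix'_toLin', LinearMap.toMatrix'_toLin',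
      sum_tuple_prod_eq_sum_sum (m + 1) (fun Y' : Fin (m + 1) → SpaceTimeIdx L M × SectorLeg N =>
        (∏ i, T (x'' i, σ'' i) (Y' i)) * kernel ℂ (sectorPreimage β F G) (m + 1) Y')]
    refine sum_congr rfl fun σ' _ => sum_congr rfl fun x' _ => ?_
    congr 1
    simpa only [Pi.smul_apply, smul_eq_mul] using kernel_sectorPreimage_eq_sectorisedKernel β F G (m + 1) (fun i => (x' i, σ' i))
  -- the generic split bookkeeping
  rw [hubbardSectorKernelNorm_def, hker]
  have href := sectorisedKernelNorm_refine_le_split (𝕜 := ℂ) hε T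
    (fun (ℓ'' : SectorLeg N') (ℓ' : SectorLeg N) => child ℓ''.1.1 ℓ'.1.1 ∧ ℓ'.1.2 = ℓ''.1.2 ∧ ℓ'.2 = ℓ''.2)
    (fun x'' ℓ'' x' ℓ' h => sectorAnalysis_mul_sectorSub_eq_zero_of_not_child β F' Ft child hchild x'' ℓ'' x' ℓ' h)
    hc₁0 hcr0 hR₁ hR₂ (fun ℓ'' x' ℓ' => hcol₁ ℓ'' (x', ℓ')) hrow' A'' B
    (fun σ' hσ' p ℓ'' => by convert hRoff σ' hσ' p ℓ'' using 4) (fun σ' hσ' p ℓ'' => by convert hRon σ' hσ' p ℓ'' using 4)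
    ((((imagTimeWeight β M : ℝ) : ℂ) ^ (m + 1)) • sectorisedKernel L M β F G (m + 1))
  refine href.trans (le_of_eq ?_)
  have hn : ‖(((imagTimeWeight β M : ℝ) : ℂ) ^ (m + 1))‖ = imagTimeWeight β M ^ (m + 1) := by
    rw [norm_pow, Complex.norm_real, Real.norm_of_nonneg hε]
  rw [sectorisedKernelNorm_smul, sectorisedKernelNorm_smul, hn, ← hubbardSectorKernelNorm_def, ← hubbardSectorKernelNorm_def]
  ring


/-- **Per-tuple pinned sizes across a plateau pair** (BGM 2006 (2.82), one overlap `L¹` norm per leg, NO sector sum): for a thin/fat pair `F, F̃`,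
a family `F′` in the plateau of `F`, a relation `child` containing the support overlap, per-pair position sums of `‖E(F′)S(F̃)‖` — fine position
summed `≤ c₁`, coarse position summed `≤ c₁r` —, at most `P` coarse label tuples of which a fine tuple is a leg-wise child, and pinned sizes
`ε_x^m Σ_{x′_p = y} ‖W_{F,σ′}(x′)‖ ≤ B` of every single coarse tuple: for every fine tuple `σ″`, leg `p` and position `x`,
`ε_x^m Σ_{x″_p = x} ‖W_{F′,σ″}(x″)‖ ≤ c₁^m · c₁r · P · ε_x^m · (ε_x · B)`. [cite: BenfattoGiulianiMastropietro2006, §2.8 (2.82)] -/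
theorem hubbardSectorPinnedSum_refine_le_of_plateau_pair {β : ℝ} (hβ : 0 < β) (F Ft : Fin N → FreqMomentum L M → ℂ)
    (hFF : ∀ ω k, Ft ω k * F ω k = F ω k) (hF0 : ∀ k, ∑ ω, F ω k = 0 → ∀ ω, F ω k = 0) (F' : Fin N' → FreqMomentum L M → ℂ)
    (hF'pl : ∀ (ω' : Fin N') (k : FreqMomentum L M), F' ω' k ≠ 0 → ∑ ω, F ω k = 1) (G : HubbardGrassmann L M)
    (child : Fin N' → Fin N → Prop) [DecidableRel child]
    (hchild : ∀ ω'' ω', ¬ child ω'' ω' → ∀ k, F' ω'' k * Ft ω' k = 0)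
    {c₁ c₁r Pc B : ℝ} (hc₁0 : 0 ≤ c₁) (hc₁r0 : 0 ≤ c₁r) (hB0 : 0 ≤ B)
    (hcol₁ : ∀ (ℓ'' : SectorLeg N') (X' : SpaceTimeIdx L M × SectorLeg N),
      ∑ x'' : SpaceTimeIdx L M, ‖(sectorAnalysisMatrix L M β F' * sectorSubMatrix L M β Ft) (x'', ℓ'') X'‖ ≤ c₁)
    (hrow₁ : ∀ (X'' : SpaceTimeIdx L M × SectorLeg N') (ℓ' : SectorLeg N),
      ∑ x' : SpaceTimeIdx L M, ‖(sectorAnalysisMatrix L M β F' * sectorSubMatrix L M β Ft) X'' (x', ℓ')‖ ≤ c₁r)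
    (m : ℕ)
    (hPc : ∀ σ'' : Fin (m + 1) → SectorLeg N',
      (((univ.filter fun σ' : Fin (m + 1) → SectorLeg N =>
          ∀ i, child (σ'' i).1.1 (σ' i).1.1 ∧ (σ' i).1.2 = (σ'' i).1.2 ∧ (σ' i).2 = (σ'' i).2).card : ℝ)) ≤ Pc)
    (hBF : ∀ (σ' : Fin (m + 1) → SectorLeg N) (p : Fin (m + 1)) (y : SpaceTimeIdx L M),
      imagTimeWeight β M ^ m * ∑ x' ∈ univ.filter (fun x' : Fin (m + 1) → SpaceTimeIdx L M => x' p = y),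
        ‖sectorisedKernel L M β F G (m + 1) σ' x'‖ ≤ B)
    (σ'' : Fin (m + 1) → SectorLeg N') (p : Fin (m + 1)) (x : SpaceTimeIdx L M) :
    imagTimeWeight β M ^ m * ∑ x'' ∈ univ.filter (fun x'' : Fin (m + 1) → SpaceTimeIdx L M => x'' p = x),
        ‖sectorisedKernel L M β F' G (m + 1) σ'' x''‖ ≤
      c₁ ^ m * c₁r * Pc * imagTimeWeight β M ^ m * (imagTimeWeight β M * B) := by
  have hε : 0 ≤ imagTimeWeight β M := imagTimeWeight_nonneg hβ.le M
  set T : SpaceTimeIdx L M × SectorLeg N' → SpaceTimeIdx L M × SectorLeg N → ℂ :=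
    fun X'' X' => (sectorAnalysisMatrix L M β F' * sectorSubMatrix L M β Ft) X'' X' with hT
  -- the fine sectorised kernels are the leg-wise transform of `ε^{m+1} ·` the coarse ones
  have hker : ∀ x'' : Fin (m + 1) → SpaceTimeIdx L M, sectorisedKernel L M β F' G (m + 1) σ'' x'' =
      ∑ σ' : Fin (m + 1) → SectorLeg N, ∑ x' : Fin (m + 1) → SpaceTimeIdx L M,
        (∏ i, T (x'' i, σ'' i) (x' i, σ' i)) *
          ((((imagTimeWeight β M : ℝ) : ℂ) ^ (m + 1)) • sectorisedKernel L M β F G (m + 1)) σ' x' := by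
    intro x''
    have h1 : kernel ℂ (ExteriorAlgebra.map (Matrix.toLin' (sectorAnalysisMatrix L M β F')) G) (m + 1) (fun i => (x'' i, σ'' i)) =
        sectorisedKernel L M β F' G (m + 1) σ'' x'' := by
      simpa only using kernel_map_sectorAnalysis β F' G (m + 1) (fun i => (x'' i, σ'' i))
    rw [← h1, map_sectorAnalysis_eq_map_comp_sectorPreimage_of_plateau hβ.ne' F Ft hFF hF0 F' hF'pl G, kernel_map,
      LinearMap.toMatrix'_comp, LinearMap.toMatrix'_toLin', LinearMap.toMatrix'_toLin',
      sum_tuple_prod_eq_sum_sum (m + 1) (fun Y' : Fin (m + 1) → SpaceTimeIdx L M × SectorLeg N =>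
        (∏ i, T (x'' i, σ'' i) (Y' i)) * kernel ℂ (sectorPreimage β F G) (m + 1) Y')]
    refine sum_congr rfl fun σ' _ => sum_congr rfl fun x' _ => ?_
    congr 1
    simpa only [Pi.smul_apply, smul_eq_mul] using kernel_sectorPreimage_eq_sectorisedKernel β F G (m + 1) (fun i => (x' i, σ' i))
  -- the pinned sizes of `ε^{m+1} · W_F` are `ε^{m+1} ·` those of `W_F`
  have hBW : ∀ (σ' : Fin (m + 1) → SectorLeg N) (q : Fin (m + 1)) (y : SpaceTimeIdx L M),
      imagTimeWeight β M ^ m * ∑ x' ∈ univ.filter (fun x' : Fin (m + 1) → SpaceTimeIdx L M => x' q = y),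
        ‖((((imagTimeWeight β M : ℝ) : ℂ) ^ (m + 1)) • sectorisedKernel L M β F G (m + 1)) σ' x'‖ ≤
        imagTimeWeight β M ^ (m + 1) * B := by
    intro σ' q y
    have hn : ∀ x', ‖((((imagTimeWeight β M : ℝ) : ℂ) ^ (m + 1)) • sectorisedKernel L M β F G (m + 1)) σ' x'‖ =
        imagTimeWeight β M ^ (m + 1) * ‖sectorisedKernel L M β F G (m + 1) σ' x'‖ := by
      intro x'
      rw [Pi.smul_apply, Pi.smul_apply, smul_eq_mul, norm_mul, norm_pow, Complex.norm_real, Real.norm_of_nonneg hε]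
    simp_rw [hn]
    rw [← mul_sum, mul_left_comm]
    exact mul_le_mul_of_nonneg_left (hBF σ' q y) (pow_nonneg hε _)
  have hmain := pinnedSum_refine_le (𝕜 := ℂ) hε T
    (fun (ℓ'' : SectorLeg N') (ℓ' : SectorLeg N) => child ℓ''.1.1 ℓ'.1.1 ∧ ℓ'.1.2 = ℓ''.1.2 ∧ ℓ'.2 = ℓ''.2)
    (fun x'' ℓ'' x' ℓ' h => sectorAnalysis_mul_sectorSub_eq_zero_of_not_child β F' Ft child hchild x'' ℓ'' x' ℓ' h)
    hc₁0 hc₁r0 (mul_nonneg (pow_nonneg hε _) hB0) (fun ℓ'' x' ℓ' => hcol₁ ℓ'' (x', ℓ')) (fun x'' ℓ'' ℓ' => hrow₁ (x'', ℓ'') ℓ')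
    (fun σ''₀ => by convert hPc σ''₀ using 4)
    ((((imagTimeWeight β M : ℝ) : ℂ) ^ (m + 1)) • sectorisedKernel L M β F G (m + 1)) hBW σ'' p x
  calc imagTimeWeight β M ^ m * ∑ x'' ∈ univ.filter (fun x'' : Fin (m + 1) → SpaceTimeIdx L M => x'' p = x),
        ‖sectorisedKernel L M β F' G (m + 1) σ'' x''‖
      = imagTimeWeight β M ^ m * ∑ x'' ∈ univ.filter (fun x'' : Fin (m + 1) → SpaceTimeIdx L M => x'' p = x),
          ‖∑ σ' : Fin (m + 1) → SectorLeg N, ∑ x' : Fin (m + 1) → SpaceTimeIdx L M,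
            (∏ i, T (x'' i, σ'' i) (x' i, σ' i)) *
              ((((imagTimeWeight β M : ℝ) : ℂ) ^ (m + 1)) • sectorisedKernel L M β F G (m + 1)) σ' x'‖ := by
        refine congrArg _ (sum_congr rfl fun x'' _ => ?_)
        rw [hker x'']
    _ ≤ c₁ ^ m * c₁r * Pc * (imagTimeWeight β M ^ (m + 1) * B) := hmain
    _ = c₁ ^ m * c₁r * Pc * imagTimeWeight β M ^ m * (imagTimeWeight β M * B) := by ring

end Literature.MathematicalPhysics.QuantumLattice

end
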